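import Summits.BirchSwinnertonDyer.BirchSwinnertonDyer.Theorems.ErratumRoadFiveShimuraKolyvaginOrderBoundInertShiftCebotarev
import Literature.NumberTheory.EllipticCurves.McCallum1991.EigenclassesCebotarevLevelPow
import HarnessLib

/-!
# T1 JET (cell `bsd-jet`), road K, Ш-half of Jetchev Cor. 1.5 at `p ∣ N` — McCallum Cor. 3.2 for
# `τ`-eigenclasses of `H¹(K, E[p])` with Kolyvagin primes of DEPTH `M₀ + 1` (the `h3` input of the
# divided descent)

HONEST FRAMING (programme file `BSD-LIT2PART-PROGRAMME-v1.md` §HONESTY, verbatim): «no tranche here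
proves BSD; ARM L moves the LITERAL column of an r ≤ 1 census into the kernel-proved-modulo-named-print
column.» THEOREMS ONLY (seat `bsd-jet-pv-1`, session g9; `--supports stmt-BirchSwinnertonDyer-14418`,
helper); nothing is booked; 0 classes move. UNCONDITIONAL (Čebotarev density theorem and the Weil
pairing are tree theorems: `Automorphic.chebotarev_artinRep_holds`, `exists_weilPairing_holds`).

WHAT. The `cebotarev` field of `KolyvaginDescent.Hypotheses` (McCallum 1991 Cor. 3.2 at `M = 1` for
`τ`-eigenclasses: independent eigenclasses `c₁,…,c_r ∈ H¹(K, E[p])` acquire prescribed local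
(non-)vanishing `N_i ∈ {0,1}` at infinitely many Kolyvagin primes) with the Kolyvagin primes
RESTRICTED to `Frob(ℓ) = Frob(∞)` on `K(E[p^{M₀+1}])`, i.e. Zhang index `M(ℓ) ≥ M₀ + 1` — the primes
at which the divided classes `P_n ∕ p^{M₀}` are defined. This is stepL shim-p1's level-shift theorem
`McCallum1991_cor_3_2_pow_shift_of_chebotarev` (classes at level `p^M`, primes of depth `M + k`,
PROVED from the Čebotarev density theorem) at `M = 1`, `k = M₀`, rewritten in the `h3` shape of
`JET.DividedDescent.exists_hypotheses_of_localData_of_kol` (`§1`), and its Zhang-currency corollary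
(`§2`: `Zhang2014.IsKolyvaginPrime ∧ M₀ + 1 ≤ Zhang2014.kolyvaginIndex`, by raising the bound above
`N_E` and `McCallum1991.le_kolyvaginIndex_of_frobEqFrobInfty`).
References: [cite: McCallumLMS1991, §3 Cor. 3.2 (with Prop. 3.1), §4 (pp. 299–300), Lemma 4.6]
[cite: GrossLMS1991, §3 (3.1)–(3.3), §9] [cite: WZhang2014, Notations (xii)]. Design: no definitions;
`K : Type`. Axioms: `propext`, `Classical.choice`, `Quot.sound`.
-/

set_option autoImplicit false

noncomputable section

open scoped Classical

open WeierstrassCurve NumberField IsDedekindDomain Literature.NumberTheory.EllipticCurves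
  Literature.NumberTheory.EllipticCurves.ModularForms

namespace Summit.BirchSwinnertonDyer.Rank1Residual.JET.DividedDescent

-- `K : Type`: the Zhang-index comparison `McCallum1991.le_kolyvaginIndex_of_frobEqFrobInfty` is universe `0`.
variable {N : ℕ} [NeZero N] {W : WeierstrassCurve ℚ} {K : Type} [Field K] [NumberField K]

/-! ### §1 Gross currency: `IsKolyvaginPrime N W K p ℓ ∧ FrobEqFrobInfty W K (p^{1+M₀}) ℓ` -/

/-- **McCallum Cor. 3.2 for `τ`-eigenclasses of `H¹(K, E[p^1])`, Kolyvagin primes of depth `1 + M₀`,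
in the `h3` shape.** For `K` imaginary quadratic, `p` odd with `ρ̄_{E,p}` onto, `c ≠ 1` in `Aut(K/ℚ)`,
`τ`-eigenclasses `c_i ∈ H¹(K, E[p^1])` and `N_i ≤ 1` with the independence «`Σ a_i c_i = 0 ⟹ p ∣ a_i`»:
above every bound `b` there is a Kolyvagin prime `ℓ` with `Frob(ℓ) = Frob(∞)` on `K(E[p^{1+M₀}])` and
`c_{i,λ} = 0 ⟺ N_i = 0` at the place `λ ∋ ℓ`. Proof: `McCallum1991_cor_3_2_pow_shift_of_chebotarev`
(`M = 1`, `k = M₀`) with the bookkeeping `c_i ≠ 0`, `a_i c_i = 0` from `p ∣ a_i`.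
[cite: McCallumLMS1991, §3 Cor. 3.2, §4 Lemma 4.6] [cite: GrossLMS1991, §3 (3.2), §9] -/
theorem chebotarev_levelOne_shift [W.IsElliptic] (hK : IsImaginaryQuadratic K) {p : ℕ} (hp : p.Prime)
    (hp2 : p ≠ 2) (hρ : W.HasSurjectiveModNGaloisRep p) (M₀ : ℕ) {c : K ≃ₐ[ℚ] K} (hc : c ≠ 1)
    (r : ℕ) (cs : Fin r → galH1Torsion (W.baseChange K) ((p ^ 1 : ℕ) : ℤ))
    (hτ : ∀ i, ∃ e : ℤ, (e = 1 ∨ e = -1) ∧ conjAct W c ((p ^ 1 : ℕ) : ℤ) (cs i) = e • cs i)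
    (Nv : Fin r → ℕ) (hN : ∀ i, Nv i ≤ 1)
    (hind : ∀ a : Fin r → ℤ, ∑ i, a i • cs i = 0 → ∀ i, (p : ℤ) ∣ a i) (b : ℕ) :
    ∃ ℓ : ℕ, b < ℓ ∧ (IsKolyvaginPrime N W K p ℓ ∧ FrobEqFrobInfty W K (p ^ (1 + M₀)) ℓ) ∧
      ∀ i, ∀ v : HeightOneSpectrum (𝓞 K), (ℓ : 𝓞 K) ∈ v.asIdeal →
        (cs i ∈ (W.baseChange K).torsionLocalKer (v.adicCompletion K) ((p ^ 1 : ℕ) : ℤ) ↔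
          Nv i = 0) := by
  -- `p` kills `H¹(K, E[p^1])`
  have hpn : ∀ x : galH1Torsion (W.baseChange K) ((p ^ 1 : ℕ) : ℤ), (p : ℤ) • x = 0 := fun x ↦ by
    have h := zsmul_discreteH1_torsion ((p ^ 1 : ℕ) : ℤ) x
    have e : ((p : ℕ) : ℤ) = ((p ^ 1 : ℕ) : ℤ) := by rw [pow_one]
    rw [e]
    exact h
  -- independence in the `a_i c_i = 0` form, and non-vanishing of each `c_i`
  have hind' : ∀ a : Fin r → ℤ, ∑ i, a i • cs i = 0 → ∀ i, a i • cs i = 0 := by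
    intro a ha i
    obtain ⟨m, hm⟩ := hind a ha i
    rw [hm, mul_comm, mul_smul, hpn]
    exact zsmul_zero m
  have h0 : ∀ i, cs i ≠ 0 := by
    intro i hi
    have hsum : ∑ j, (Pi.single i (1 : ℤ) : Fin r → ℤ) j • cs j = 0 := by
      rw [Finset.sum_eq_single i]
      · rw [Pi.single_eq_same, one_smul, hi]
      · intro j _ hj
        rw [Pi.single_eq_of_ne hj, zero_smul]
      · intro h; exact absurd (Finset.mem_univ i) h
    have h1 : (p : ℤ) ∣ (Pi.single i (1 : ℤ) : Fin r → ℤ) i := hind _ hsum i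
    rw [Pi.single_eq_same] at h1
    have := Int.eq_one_of_dvd_one (Int.natCast_nonneg p) h1
    have h2 : p = 1 := by exact_mod_cast this
    exact hp.one_lt.ne' h2
  have hN' : ∀ i, Nv i ≠ 0 → ((p : ℤ) ^ (Nv i - 1)) • cs i ≠ 0 := by
    intro i hi
    have h1 : Nv i = 1 := le_antisymm (hN i) (Nat.one_le_iff_ne_zero.mpr hi)
    rw [h1, Nat.sub_self, pow_zero, one_smul]
    exact h0 i
  obtain ⟨ℓ, hbℓ, hKol, hfrob, hloc⟩ :=
    Summit.BirchSwinnertonDyer.BirchSwinnertonDyer.Theorems.McCallum1991_cor_3_2_pow_shift_of_chebotarev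
      (N := N) Literature.NumberTheory.Automorphic.chebotarev_artinRep_holds hK hp hp2 hρ
      (W.exists_weilPairing_holds p) (M := 1) le_rfl M₀ hc cs h0 Nv hN' hτ hind' b
  refine ⟨ℓ, hbℓ, ⟨hKol, hfrob⟩, fun i v hv ↦ ?_⟩
  obtain ⟨hmem, hnot⟩ := hloc i v hv
  constructor
  · intro h
    by_contra hi
    have h1 : Nv i = 1 := le_antisymm (hN i) (Nat.one_le_iff_ne_zero.mpr hi)
    apply hnot hi
    rw [h1, Nat.sub_self, pow_zero, one_smul]
    exact h
  · intro hi
    rw [hi, pow_zero, one_smul] at hmem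
    exact hmem

/-! ### §2 Zhang currency: `Zhang2014.IsKolyvaginPrime ∧ M₀ + 1 ≤ Zhang2014.kolyvaginIndex` as well -/

/-- **The same with the output prime also recorded in Zhang's currency** (`W` globally minimal, the
bound raised above `N_E` so that `ℓ ∤ N_E`): `ℓ` is a Gross–Kolyvagin prime with `Frob(ℓ) = Frob(∞)`
on `K(E[p^{M₀+1}])`, a Zhang–Kolyvagin prime of level `N`, and `M(ℓ) ≥ M₀ + 1`
(`McCallum1991.le_kolyvaginIndex_of_frobEqFrobInfty`: `p^{M₀+1} ∣ ℓ + 1`, `p^{M₀+1} ∣ a_ℓ`). This is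
the `h3` input of `exists_hypotheses_of_localData_of_kol` for the predicate
`Kol ℓ := IsKolyvaginPrime ∧ FrobEqFrobInfty (p^{M₀+1}) ∧ Zhang2014.IsKolyvaginPrime ∧ M₀ + 1 ≤ M(ℓ)`
used by the divided descent. [cite: McCallumLMS1991, §3 Cor. 3.2, §4 (pp. 299–300)]
[cite: WZhang2014, Notations (xii)] -/
theorem chebotarev_levelOne_shift_zhang [W.IsElliptic] [W.IsGloballyMinimal]
    (hK : IsImaginaryQuadratic K) {p : ℕ} (hp : p.Prime) (hp2 : p ≠ 2)
    (hρ : W.HasSurjectiveModNGaloisRep p) (M₀ : ℕ) {c : K ≃ₐ[ℚ] K} (hc : c ≠ 1)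
    (r : ℕ) (cs : Fin r → galH1Torsion (W.baseChange K) ((p ^ 1 : ℕ) : ℤ))
    (hτ : ∀ i, ∃ e : ℤ, (e = 1 ∨ e = -1) ∧ conjAct W c ((p ^ 1 : ℕ) : ℤ) (cs i) = e • cs i)
    (Nv : Fin r → ℕ) (hN : ∀ i, Nv i ≤ 1)
    (hind : ∀ a : Fin r → ℤ, ∑ i, a i • cs i = 0 → ∀ i, (p : ℤ) ∣ a i) (b : ℕ) :
    ∃ ℓ : ℕ, b < ℓ ∧
      (IsKolyvaginPrime N W K p ℓ ∧ FrobEqFrobInfty W K (p ^ (M₀ + 1)) ℓ ∧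
        Zhang2014.IsKolyvaginPrime N W K p ℓ ∧ M₀ + 1 ≤ Zhang2014.kolyvaginIndex W p ℓ) ∧
      ∀ i, ∀ v : HeightOneSpectrum (𝓞 K), (ℓ : 𝓞 K) ∈ v.asIdeal →
        (cs i ∈ (W.baseChange K).torsionLocalKer (v.adicCompletion K) ((p ^ 1 : ℕ) : ℤ) ↔
          Nv i = 0) := by
  obtain ⟨ℓ, hbℓ, ⟨hKol, hfrob⟩, hloc⟩ :=
    chebotarev_levelOne_shift (N := N) hK hp hp2 hρ M₀ hc r cs hτ Nv hN hind
      (max b (W.conductorNorm ℤ))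
  have hb : b < ℓ := lt_of_le_of_lt (le_max_left _ _) hbℓ
  have hℓNE : ¬ ℓ ∣ W.conductorNorm ℤ := fun h ↦ by
    have h1 := Nat.le_of_dvd W.conductorNorm_pos_holds h
    have h2 := lt_of_le_of_lt (le_max_right b (W.conductorNorm ℤ)) hbℓ
    omega
  have hfrob' : FrobEqFrobInfty W K (p ^ (M₀ + 1)) ℓ := by rw [Nat.add_comm]; exact hfrob
  have hKol' := hKol
  obtain ⟨hℓP, hℓN, hℓD, hℓp, hinert, -⟩ := hKol'
  have hidx : M₀ + 1 ≤ Zhang2014.kolyvaginIndex W p ℓ :=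
    McCallum1991.le_kolyvaginIndex_of_frobEqFrobInfty W K hp (by omega) hℓP hℓp hℓNE hfrob'
  exact ⟨ℓ, hb, ⟨hKol, hfrob', ⟨hℓP, hℓN, hℓD, hℓp, hinert, lt_of_lt_of_le (by omega) hidx⟩, hidx⟩,
    hloc⟩

end Summit.BirchSwinnertonDyer.Rank1Residual.JET.DividedDescent

end
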